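import Literature.RepresentationTheory.HeisenbergGroup.SchrodingerL2Haar
import Mathlib.Analysis.Normed.Operator.ContinuousLinearMap
import Mathlib.Topology.Algebra.Module.Equiv
import HarnessLib

/-!
# Transport of the `L²` Schrödinger representation: measure-preserving additive equivalences, change of pairing,
# rescaling of the Haar measure, and the transfer of irreducibility

Topic `RepresentationTheory/HeisenbergGroup`; namespace `Literature.RepresentationTheory.HeisenbergGroup.SchrodingerHaar`.
KERNEL ONLY: theorems (existence statements instead of definitions); no named fact, no record, no `sorry`.

`SchrodingerL2Haar.lean` constructs `SchrodingerHaar.rep β ψ hψ hβ ν`, the Schrödinger representation of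
`Heisenberg (polar β)` on `Lp ℂ 2 ν`, `(ρ((x, y), t) f)(u) = ψ(t + β(u, y)) f(u + x)` ([Weil1964, Chap. I n° 4 p. 149,
n° 11–13]).  Realising the `L²` model of [GelbartRogawski1991, §3.1 p. 454 L19–21]'s `ρ_ψ` on `L²(𝐀_Fⁿ)` requires moving
this representation along the standard identifications `𝐀_Fⁿ ≅ (F ⊗ ℝ)ⁿ × (𝐀_F^∞)ⁿ`, `(F ⊗ ℝ)ⁿ ≅ ℝᴺ`, between Gram
matrices, and between Haar measures differing by a constant.  This file supplies that bookkeeping once and for all: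

* §1 `exists_linearIsometryEquiv_compMeasurePreserving` — a measure-preserving map with a measure-preserving two-sided
  inverse induces a UNITARY `L²(μ₂) ≃ L²(μ₁)`, `F ↦ F ∘ S` (Mathlib's `Lp.compMeasurePreserving` both ways);
* §2 `compMeasurePreserving_translate` / `_modulate` / `_rep` — along an ADDITIVE measure-preserving `S : X₁ → X₂`,
  `F ↦ F ∘ S` carries the translation by `S x₁` to the translation by `x₁`, the modulation by `ψ₂(β₂(·, y₂))` to the
  modulation by `ψ₁(β₁(·, y₁))` whenever `ψ₂(β₂(S a, y₂)) = ψ₁(β₁(a, y₁))`, hence `ρ₂((S x₁, y₂), t₂)` to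
  `ρ₁((x₁, y₁), t₁)` (`ψ₂ t₂ = ψ₁ t₁`); `rep_eq_rep_of_forall_apply` — on ONE space, two pairings/characters with the
  same multipliers give the same operators (change of Gram matrix `β(u, T y) ↔ β(u, y')`);
* §3 `irreducible_of_irreducible_of_semiconj` — if every operator of a family `ρ` on `E` is conjugate under a
  continuous linear equivalence `V : E ≃L E'` to an operator of a family `ρ'` on `E'`, irreducibility (no closed
  invariant subspace other than `⊥`, `⊤`) passes from `ρ` to `ρ'`;
* §4 `exists_continuousLinearEquiv_smul_measure`, `rep_smul_measure_semiconj`, `irreducible_smul_measure_iff` —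
  `L²(c • ν) ≃L L²(ν)` (same a.e. classes, `c ≠ 0, ∞`) intertwines the two Schrödinger representations, so
  irreducibility does not depend on the normalisation of the Haar measure.

Nothing of the cited sources is asserted; everything is proved from Mathlib and the tree.

## References
* [Weil1964] A. Weil, *Sur certains groupes d'opérateurs unitaires*, Acta Math. 111 (1964), Chap. I n° 4 p. 149, n° 11–13.
* [MoeglinVignerasWaldspurger1987] C. Mœglin, M.-F. Vignéras, J.-L. Waldspurger, LNM 1291 (1987), Chap. 2 I.3–I.4.
* [GelbartRogawski1991] S. Gelbart, J. Rogawski, Invent. Math. 105 (1991), §3.1 p. 454 L19–21.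
-/

set_option autoImplicit false

noncomputable section

open MeasureTheory Filter Set
open scoped ENNReal Topology

namespace Literature.RepresentationTheory.HeisenbergGroup

namespace SchrodingerHaar

/-! ## §1 The unitary of a measure-preserving equivalence -/

section Unitary

variable {X₁ X₂ : Type*} [MeasurableSpace X₁] [MeasurableSpace X₂] {μ₁ : Measure X₁} {μ₂ : Measure X₂}

/-- `F ↦ F ∘ S` is `ℂ`-linear (Mathlib's `Lp.compMeasurePreservingₗ`). [cite: Weil1964, Chap. I n° 11] -/
theorem compMeasurePreserving_smul {S : X₁ → X₂} (hS : MeasurePreserving S μ₁ μ₂) (a : ℂ) (F : Lp ℂ 2 μ₂) :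
    Lp.compMeasurePreserving S hS (a • F) = a • Lp.compMeasurePreserving S hS F := by
  rcases F with ⟨⟨_⟩, _⟩; rfl

/-- **`F ↦ F ∘ S` is a unitary `L²(μ₂) ≃ L²(μ₁)`** when `S : X₁ → X₂` is measure preserving with a measure-preserving
two-sided inverse `S'` (its inverse is `G ↦ G ∘ S'`). [cite: Weil1964, Chap. I n° 11] -/
theorem exists_linearIsometryEquiv_compMeasurePreserving {S : X₁ → X₂} {S' : X₂ → X₁}
    (hS : MeasurePreserving S μ₁ μ₂) (hS' : MeasurePreserving S' μ₂ μ₁) (h₁ : ∀ a, S' (S a) = a)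
    (h₂ : ∀ b, S (S' b) = b) :
    ∃ U : Lp ℂ 2 μ₂ ≃ₗᵢ[ℂ] Lp ℂ 2 μ₁, (∀ F, U F = Lp.compMeasurePreserving S hS F) ∧
      ∀ G, U.symm G = Lp.compMeasurePreserving S' hS' G := by
  have hl : ∀ F : Lp ℂ 2 μ₂, Lp.compMeasurePreserving S' hS' (Lp.compMeasurePreserving S hS F) = F := fun F => by
    rw [← Lp.compMeasurePreserving_comp_apply]
    apply Lp.ext
    filter_upwards [Lp.coeFn_compMeasurePreserving F (hS.comp hS')] with b hb
    rw [hb, Function.comp_apply, Function.comp_apply, h₂]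
  have hr : ∀ G : Lp ℂ 2 μ₁, Lp.compMeasurePreserving S hS (Lp.compMeasurePreserving S' hS' G) = G := fun G => by
    rw [← Lp.compMeasurePreserving_comp_apply]
    apply Lp.ext
    filter_upwards [Lp.coeFn_compMeasurePreserving G (hS'.comp hS)] with a ha
    rw [ha, Function.comp_apply, Function.comp_apply, h₁]
  let e : Lp ℂ 2 μ₂ ≃ₗ[ℂ] Lp ℂ 2 μ₁ :=
    { toFun := Lp.compMeasurePreserving S hS
      map_add' := fun F G => map_add _ F G
      map_smul' := compMeasurePreserving_smul hS
      invFun := Lp.compMeasurePreserving S' hS'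
      left_inv := hl
      right_inv := hr }
  exact ⟨{ toLinearEquiv := e, norm_map' := fun F => Lp.norm_compMeasurePreserving F hS }, fun F => rfl,
    fun G => rfl⟩

end Unitary

/-! ## §2 Transport of translations, modulations and `ρ` along an additive measure-preserving map -/

section Transport

variable {R₁ R₂ : Type*} [CommRing R₁] [CommRing R₂] {X₁ Y₁ X₂ Y₂ : Type*}
  [AddCommGroup X₁] [Module R₁ X₁] [AddCommGroup Y₁] [Module R₁ Y₁]
  [AddCommGroup X₂] [Module R₂ X₂] [AddCommGroup Y₂] [Module R₂ Y₂]
  (β₁ : X₁ →ₗ[R₁] Y₁ →ₗ[R₁] R₁) (β₂ : X₂ →ₗ[R₂] Y₂ →ₗ[R₂] R₂) (ψ₁ : AddChar R₁ Circle) (ψ₂ : AddChar R₂ Circle)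
  [TopologicalSpace R₁] [TopologicalSpace R₂] [TopologicalSpace X₁] [TopologicalSpace X₂]
  (hψ₁ : Continuous (ψ₁ : R₁ → Circle)) (hψ₂ : Continuous (ψ₂ : R₂ → Circle))
  (hβ₁ : ∀ y : Y₁, Continuous fun u : X₁ => β₁ u y) (hβ₂ : ∀ y : Y₂, Continuous fun u : X₂ => β₂ u y)
  [MeasurableSpace X₁] [BorelSpace X₁] [MeasurableSpace X₂] [BorelSpace X₂] (μ₁ : Measure X₁) (μ₂ : Measure X₂)
  {S : X₁ →+ X₂} (hS : MeasurePreserving S μ₁ μ₂)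

/-- **`F ↦ F ∘ S` carries the modulation by `ψ₂(β₂(·, y₂))` to the modulation by `ψ₁(β₁(·, y₁))`** as soon as the two
multipliers agree along `S`. [cite: Weil1964, Chap. I n° 4 p. 149] -/
theorem compMeasurePreserving_modulate {y₁ : Y₁} {y₂ : Y₂} (hy : ∀ a : X₁, ψ₂ (β₂ (S a) y₂) = ψ₁ (β₁ a y₁))
    (F : Lp ℂ 2 μ₂) :
    Lp.compMeasurePreserving S hS (modulate β₂ ψ₂ hψ₂ hβ₂ μ₂ y₂ F) =
      modulate β₁ ψ₁ hψ₁ hβ₁ μ₁ y₁ (Lp.compMeasurePreserving S hS F) := by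
  apply Lp.ext
  have e₁ := hS.quasiMeasurePreserving.ae_eq_comp (modulate_coeFn β₂ ψ₂ hψ₂ hβ₂ μ₂ y₂ F)
  filter_upwards [Lp.coeFn_compMeasurePreserving (modulate β₂ ψ₂ hψ₂ hβ₂ μ₂ y₂ F) hS, e₁,
    modulate_coeFn β₁ ψ₁ hψ₁ hβ₁ μ₁ y₁ (Lp.compMeasurePreserving S hS F),
    Lp.coeFn_compMeasurePreserving F hS] with a h1 h2 h3 h4
  simp only [Function.comp_apply] at h2
  rw [h1, Function.comp_apply, h2, h3, h4, Function.comp_apply, chi_apply, chi_apply, hy]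

variable [IsTopologicalAddGroup X₁] [μ₁.IsAddRightInvariant] [IsTopologicalAddGroup X₂] [μ₂.IsAddRightInvariant]

/-- **`F ↦ F ∘ S` carries the translation by `S x₁` to the translation by `x₁`** (`S` additive, measure preserving).
[cite: Weil1964, Chap. I n° 4 p. 149] -/
theorem compMeasurePreserving_translate (x₁ : X₁) (F : Lp ℂ 2 μ₂) :
    Lp.compMeasurePreserving S hS (translate μ₂ (S x₁) F) =
      translate μ₁ x₁ (Lp.compMeasurePreserving S hS F) := by
  apply Lp.ext
  have e₁ := hS.quasiMeasurePreserving.ae_eq_comp (translate_coeFn μ₂ (S x₁) F)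
  have e₂ := (measurePreserving_add_right μ₁ x₁).quasiMeasurePreserving.ae_eq_comp
    (Lp.coeFn_compMeasurePreserving F hS)
  filter_upwards [Lp.coeFn_compMeasurePreserving (translate μ₂ (S x₁) F) hS, e₁,
    translate_coeFn μ₁ x₁ (Lp.compMeasurePreserving S hS F), e₂] with a h1 h2 h3 h4
  simp only [Function.comp_apply] at h2 h4
  rw [h1, Function.comp_apply, h2, h3, h4, map_add]

/-- **`F ↦ F ∘ S` intertwines `ρ₂((S x₁, y₂), t₂)` with `ρ₁((x₁, y₁), t₁)`** when `ψ₂(β₂(S a, y₂)) = ψ₁(β₁(a, y₁))` for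
all `a` and `ψ₂(t₂) = ψ₁(t₁)` — the Schrödinger representation moves along additive measure-preserving maps.
[cite: Weil1964, Chap. I n° 11] -/
theorem compMeasurePreserving_rep {x₁ : X₁} {y₁ : Y₁} {t₁ : R₁} {y₂ : Y₂} {t₂ : R₂}
    (hy : ∀ a : X₁, ψ₂ (β₂ (S a) y₂) = ψ₁ (β₁ a y₁)) (ht : ψ₂ t₂ = ψ₁ t₁) (F : Lp ℂ 2 μ₂) :
    Lp.compMeasurePreserving S hS (rep β₂ ψ₂ hψ₂ hβ₂ μ₂ ⟨(S x₁, y₂), t₂⟩ F) =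
      rep β₁ ψ₁ hψ₁ hβ₁ μ₁ ⟨(x₁, y₁), t₁⟩ (Lp.compMeasurePreserving S hS F) := by
  rw [rep_apply, rep_apply, compMeasurePreserving_smul]
  change ((ψ₂ t₂ : Circle) : ℂ) • Lp.compMeasurePreserving S hS (modulate β₂ ψ₂ hψ₂ hβ₂ μ₂ y₂
      (translate μ₂ (S x₁) F)) = ((ψ₁ t₁ : Circle) : ℂ) • modulate β₁ ψ₁ hψ₁ hβ₁ μ₁ y₁
      (translate μ₁ x₁ (Lp.compMeasurePreserving S hS F))
  rw [ht, compMeasurePreserving_modulate β₁ β₂ ψ₁ ψ₂ hψ₁ hψ₂ hβ₁ hβ₂ μ₁ μ₂ hS hy,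
    compMeasurePreserving_translate μ₁ μ₂ hS]

end Transport

section SameSpace

variable {R₁ R₂ : Type*} [CommRing R₁] [CommRing R₂] {X Y₁ Y₂ : Type*}
  [AddCommGroup X] [Module R₁ X] [AddCommGroup Y₁] [Module R₁ Y₁] [Module R₂ X] [AddCommGroup Y₂] [Module R₂ Y₂]
  (β₁ : X →ₗ[R₁] Y₁ →ₗ[R₁] R₁) (β₂ : X →ₗ[R₂] Y₂ →ₗ[R₂] R₂) (ψ₁ : AddChar R₁ Circle) (ψ₂ : AddChar R₂ Circle)
  [TopologicalSpace R₁] [TopologicalSpace R₂] [TopologicalSpace X]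
  (hψ₁ : Continuous (ψ₁ : R₁ → Circle)) (hψ₂ : Continuous (ψ₂ : R₂ → Circle))
  (hβ₁ : ∀ y : Y₁, Continuous fun u : X => β₁ u y) (hβ₂ : ∀ y : Y₂, Continuous fun u : X => β₂ u y)
  [MeasurableSpace X] [BorelSpace X] (ν : Measure X)

/-- **same multiplier, same modulation**: `ψ₂(β₂(·, y₂)) = ψ₁(β₁(·, y₁))` forces `M_{y₂} = M_{y₁}` on `L²(X, ν)` (two
pairings / characters / Gram matrices on one space). [cite: Weil1964, Chap. I n° 4 p. 149] -/
theorem modulate_eq_modulate_of_forall_apply {y₁ : Y₁} {y₂ : Y₂} (hy : ∀ a : X, ψ₂ (β₂ a y₂) = ψ₁ (β₁ a y₁))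
    (F : Lp ℂ 2 ν) : modulate β₂ ψ₂ hψ₂ hβ₂ ν y₂ F = modulate β₁ ψ₁ hψ₁ hβ₁ ν y₁ F := by
  apply Lp.ext
  filter_upwards [modulate_coeFn β₂ ψ₂ hψ₂ hβ₂ ν y₂ F, modulate_coeFn β₁ ψ₁ hψ₁ hβ₁ ν y₁ F] with a h1 h2
  rw [h1, h2, chi_apply, chi_apply, hy]

variable [IsTopologicalAddGroup X] [ν.IsAddRightInvariant]

/-- **same multipliers and central values, same Schrödinger operator**: `ρ₂((x, y₂), t₂) = ρ₁((x, y₁), t₁)` on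
`L²(X, ν)` when `ψ₂(β₂(a, y₂)) = ψ₁(β₁(a, y₁))` for all `a` and `ψ₂ t₂ = ψ₁ t₁` (e.g. `β₂(u, y) = β₁(u, T y)` for a
Gram matrix `T`). [cite: Weil1964, Chap. I n° 4 p. 149] -/
theorem rep_eq_rep_of_forall_apply {x : X} {y₁ : Y₁} {t₁ : R₁} {y₂ : Y₂} {t₂ : R₂}
    (hy : ∀ a : X, ψ₂ (β₂ a y₂) = ψ₁ (β₁ a y₁)) (ht : ψ₂ t₂ = ψ₁ t₁) (F : Lp ℂ 2 ν) :
    rep β₂ ψ₂ hψ₂ hβ₂ ν ⟨(x, y₂), t₂⟩ F = rep β₁ ψ₁ hψ₁ hβ₁ ν ⟨(x, y₁), t₁⟩ F := by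
  rw [rep_apply, rep_apply]
  change ((ψ₂ t₂ : Circle) : ℂ) • modulate β₂ ψ₂ hψ₂ hβ₂ ν y₂ (translate ν x F) =
    ((ψ₁ t₁ : Circle) : ℂ) • modulate β₁ ψ₁ hψ₁ hβ₁ ν y₁ (translate ν x F)
  rw [ht, modulate_eq_modulate_of_forall_apply β₁ β₂ ψ₁ ψ₂ hψ₁ hψ₂ hβ₁ hβ₂ ν hy]

end SameSpace

/-! ## §3 Irreducibility passes along intertwining continuous linear equivalences -/

section Irreducible

variable {E E' : Type*} [AddCommGroup E] [Module ℂ E] [TopologicalSpace E] [AddCommGroup E'] [Module ℂ E']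
  [TopologicalSpace E']

/-- **transfer of irreducibility.**  `ρ : G → End E`, `ρ' : G' → End E'` two families of linear operators and
`V : E ≃L[ℂ] E'` a continuous linear equivalence such that every `V ∘ ρ(g)` is `ρ'(g') ∘ V` for some `g'`.  If `E`
has no closed `ρ`-invariant subspace other than `⊥`, `⊤`, then `E'` has no closed `ρ'`-invariant subspace other than
`⊥`, `⊤` (pull the subspace back along `V`). [cite: MoeglinVignerasWaldspurger1987, Chap. 2 I.3] -/
theorem irreducible_of_irreducible_of_semiconj {G G' : Type*} (ρ : G → E →ₗ[ℂ] E) (ρ' : G' → E' →ₗ[ℂ] E')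
    (V : E ≃L[ℂ] E') (hV : ∀ g : G, ∃ g' : G', ∀ v : E, V (ρ g v) = ρ' g' (V v))
    (hirr : ∀ K : Submodule ℂ E, IsClosed (K : Set E) → (∀ (g : G), ∀ v ∈ K, ρ g v ∈ K) → K = ⊥ ∨ K = ⊤)
    (K' : Submodule ℂ E') (hK'c : IsClosed (K' : Set E')) (hK' : ∀ (g' : G'), ∀ v ∈ K', ρ' g' v ∈ K') :
    K' = ⊥ ∨ K' = ⊤ := by
  set K : Submodule ℂ E := K'.comap (V.toLinearEquiv : E →ₗ[ℂ] E') with hK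
  have hKc : IsClosed (K : Set E) := by
    rw [hK, Submodule.comap_coe]
    exact hK'c.preimage V.continuous
  have hKρ : ∀ (g : G), ∀ v ∈ K, ρ g v ∈ K := by
    intro g v hv
    obtain ⟨g', hg'⟩ := hV g
    rw [hK, Submodule.mem_comap] at hv ⊢
    change V (ρ g v) ∈ K'
    rw [hg']
    exact hK' g' _ hv
  have hKK' : ∀ w : E', w ∈ K' ↔ V.symm w ∈ K := fun w => by
    rw [hK, Submodule.mem_comap]
    change w ∈ K' ↔ V (V.symm w) ∈ K'
    rw [ContinuousLinearEquiv.apply_symm_apply]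
  rcases hirr K hKc hKρ with h | h
  · left
    refine (Submodule.eq_bot_iff _).2 fun w hw => ?_
    have hw' : V.symm w ∈ K := (hKK' w).1 hw
    rw [h, Submodule.mem_bot] at hw'
    simpa using congrArg V hw'
  · right
    refine Submodule.eq_top_iff'.2 fun w => (hKK' w).2 ?_
    rw [h]
    exact Submodule.mem_top

end Irreducible

/-! ## §4 Rescaling the measure: `L²(c • ν) ≃L L²(ν)` intertwines the Schrödinger representations -/

section SMul

variable {X : Type*} [MeasurableSpace X] (ν : Measure X) {c : ℝ≥0∞}

/-- an `L²(c • ν)` function is `L²(ν)` (`c ≠ 0`). [cite: Weil1964, Chap. I n° 11] -/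
theorem memLp_of_memLp_smul_measure (hc0 : c ≠ 0) (hc : c ≠ ∞) {f : X → ℂ} (hf : MemLp f 2 (c • ν)) :
    MemLp f 2 ν :=
  hf.of_measure_le_smul (c := c⁻¹) (ENNReal.inv_ne_top.2 hc0)
    (le_of_eq (by rw [smul_smul, ENNReal.inv_mul_cancel hc0 hc, one_smul]))

/-- **`L²(c • ν) ≃L L²(ν)`, the identity on a.e. classes** (`c ≠ 0, ∞`; norms differ by the factor `c^{1/2}`).
[cite: Weil1964, Chap. I n° 11] -/
theorem exists_continuousLinearEquiv_smul_measure (hc0 : c ≠ 0) (hc : c ≠ ∞) :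
    ∃ V : Lp ℂ 2 (c • ν) ≃L[ℂ] Lp ℂ 2 ν, (∀ F : Lp ℂ 2 (c • ν), (V F : X → ℂ) =ᵐ[ν] F) ∧
      ∀ G : Lp ℂ 2 ν, (V.symm G : X → ℂ) =ᵐ[ν] G := by
  have hae : ae (c • ν) = ae ν := Measure.ae_ennreal_smul_measure_eq hc0 ν
  -- the two linear maps
  let A : Lp ℂ 2 (c • ν) →ₗ[ℂ] Lp ℂ 2 ν :=
    { toFun := fun F => (memLp_of_memLp_smul_measure ν hc0 hc (Lp.memLp F)).toLp F
      map_add' := fun F F' => by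
        rw [← MemLp.toLp_add]
        refine MemLp.toLp_congr _ _ ?_
        have h := Lp.coeFn_add F F'
        rw [hae] at h
        exact h
      map_smul' := fun a F => by
        rw [RingHom.id_apply, ← MemLp.toLp_const_smul]
        refine MemLp.toLp_congr _ _ ?_
        have h := Lp.coeFn_smul a F
        rw [hae] at h
        exact h }
  let B : Lp ℂ 2 ν →ₗ[ℂ] Lp ℂ 2 (c • ν) :=
    { toFun := fun G => ((Lp.memLp G).smul_measure hc).toLp G
      map_add' := fun G G' => by
        rw [← MemLp.toLp_add]
        refine MemLp.toLp_congr _ _ ?_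
        have h := Lp.coeFn_add G G'
        rw [← hae] at h
        exact h
      map_smul' := fun a G => by
        rw [RingHom.id_apply, ← MemLp.toLp_const_smul]
        refine MemLp.toLp_congr _ _ ?_
        have h := Lp.coeFn_smul a G
        rw [← hae] at h
        exact h }
  have hA : ∀ F : Lp ℂ 2 (c • ν), (A F : X → ℂ) =ᵐ[ν] F := fun F =>
    MemLp.coeFn_toLp (memLp_of_memLp_smul_measure ν hc0 hc (Lp.memLp F))
  have hB : ∀ G : Lp ℂ 2 ν, (B G : X → ℂ) =ᵐ[c • ν] G := fun G => MemLp.coeFn_toLp ((Lp.memLp G).smul_measure hc)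
  -- bounds
  have hA' : ∃ C : ℝ, ∀ F, ‖A F‖ ≤ C * ‖F‖ := by
    refine ⟨((c⁻¹) ^ (1 / (2 : ℝ≥0∞)).toReal).toReal, fun F => le_of_eq ?_⟩
    change ‖(memLp_of_memLp_smul_measure ν hc0 hc (Lp.memLp F)).toLp F‖ = _
    rw [Lp.norm_toLp, Lp.norm_def, eLpNorm_smul_measure_of_ne_top ENNReal.ofNat_ne_top, smul_eq_mul,
      ENNReal.toReal_mul, ← mul_assoc, ← ENNReal.toReal_mul, ← ENNReal.mul_rpow_of_ne_top
      (ENNReal.inv_ne_top.2 hc0) hc, ENNReal.inv_mul_cancel hc0 hc, ENNReal.one_rpow, ENNReal.toReal_one, one_mul]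
  have hB' : ∃ C : ℝ, ∀ G, ‖B G‖ ≤ C * ‖G‖ := by
    refine ⟨(c ^ (1 / (2 : ℝ≥0∞)).toReal).toReal, fun G => le_of_eq ?_⟩
    change ‖((Lp.memLp G).smul_measure hc).toLp G‖ = _
    rw [Lp.norm_toLp, Lp.norm_def, eLpNorm_smul_measure_of_ne_top ENNReal.ofNat_ne_top, smul_eq_mul,
      ENNReal.toReal_mul]
  -- inverses
  have hBA : ∀ F, B (A F) = F := fun F => by
    apply Lp.ext
    have h1 := hB (A F)
    have h2 := hA F
    rw [← hae] at h2
    exact h1.trans h2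
  have hAB : ∀ G, A (B G) = G := fun G => by
    apply Lp.ext
    have h1 := hA (B G)
    have h2 := hB G
    rw [hae] at h2
    exact h1.trans h2
  refine ⟨ContinuousLinearEquiv.equivOfInverse (A.mkContinuousOfExistsBound hA') (B.mkContinuousOfExistsBound hB')
    hBA hAB, fun F => hA F, fun G => ?_⟩
  have h := hB G
  rw [hae] at h
  exact h

variable {R : Type*} [CommRing R] {Y : Type*} [AddCommGroup X] [Module R X] [AddCommGroup Y] [Module R Y]
  (β : X →ₗ[R] Y →ₗ[R] R) (ψ : AddChar R Circle) [TopologicalSpace R] [TopologicalSpace X]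
  (hψ : Continuous (ψ : R → Circle)) (hβ : ∀ y : Y, Continuous fun u : X => β u y) [BorelSpace X]
  [IsTopologicalAddGroup X] [ν.IsAddRightInvariant]

/-- **the identity on a.e. classes intertwines `ρ` on `L²(c • ν)` with `ρ` on `L²(ν)`** (same pointwise formula).
[cite: Weil1964, Chap. I n° 11] -/
theorem rep_smul_measure_semiconj (hc0 : c ≠ 0) (V : Lp ℂ 2 (c • ν) ≃L[ℂ] Lp ℂ 2 ν)
    (hV : ∀ F : Lp ℂ 2 (c • ν), (V F : X → ℂ) =ᵐ[ν] F) (h : Heisenberg (polar β)) (F : Lp ℂ 2 (c • ν)) :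
    V (rep β ψ hψ hβ (c • ν) h F) = rep β ψ hψ hβ ν h (V F) := by
  have hae : ae (c • ν) = ae ν := Measure.ae_ennreal_smul_measure_eq hc0 ν
  apply Lp.ext
  have h1 := rep_coeFn β ψ hψ hβ (c • ν) h F
  rw [hae] at h1
  have h2 := (measurePreserving_add_right ν h.v.1).quasiMeasurePreserving.ae_eq_comp (hV F)
  filter_upwards [hV (rep β ψ hψ hβ (c • ν) h F), h1, rep_coeFn β ψ hψ hβ ν h (V F), h2] with u e1 e2 e3 e4
  simp only [Function.comp_apply] at e4
  rw [e1, e2, e3, e4]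

/-- **irreducibility of the Schrödinger representation does not depend on the normalisation of the measure**: for
`c ≠ 0, ∞`, `L²(ν)` has no closed `ρ`-invariant subspace other than `⊥`, `⊤` iff `L²(c • ν)` has none.
[cite: MoeglinVignerasWaldspurger1987, Chap. 2 I.3] -/
theorem irreducible_smul_measure_iff (hc0 : c ≠ 0) (hc : c ≠ ∞) :
    (∀ K : Submodule ℂ (Lp ℂ 2 ν), IsClosed (K : Set (Lp ℂ 2 ν)) →
        (∀ (h : Heisenberg (polar β)), ∀ F ∈ K, rep β ψ hψ hβ ν h F ∈ K) → K = ⊥ ∨ K = ⊤) ↔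
      ∀ K : Submodule ℂ (Lp ℂ 2 (c • ν)), IsClosed (K : Set (Lp ℂ 2 (c • ν))) →
        (∀ (h : Heisenberg (polar β)), ∀ F ∈ K, rep β ψ hψ hβ (c • ν) h F ∈ K) → K = ⊥ ∨ K = ⊤ := by
  obtain ⟨V, hV, hV'⟩ := exists_continuousLinearEquiv_smul_measure ν hc0 hc
  have hsemi : ∀ (h : Heisenberg (polar β)) (F : Lp ℂ 2 (c • ν)),
      V (rep β ψ hψ hβ (c • ν) h F) = rep β ψ hψ hβ ν h (V F) :=
    rep_smul_measure_semiconj ν β ψ hψ hβ hc0 V hV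
  have hsemi' : ∀ (h : Heisenberg (polar β)) (G : Lp ℂ 2 ν),
      V.symm (rep β ψ hψ hβ ν h G) = rep β ψ hψ hβ (c • ν) h (V.symm G) := fun h G => by
    rw [ContinuousLinearEquiv.symm_apply_eq, hsemi, ContinuousLinearEquiv.apply_symm_apply]
  constructor
  · intro hirr
    exact irreducible_of_irreducible_of_semiconj (fun h => rep β ψ hψ hβ ν h) (fun h => rep β ψ hψ hβ (c • ν) h)
      V.symm (fun h => ⟨h, hsemi' h⟩) hirr
  · intro hirr
    exact irreducible_of_irreducible_of_semiconj (fun h => rep β ψ hψ hβ (c • ν) h) (fun h => rep β ψ hψ hβ ν h)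
      V (fun h => ⟨h, hsemi h⟩) hirr

end SMul

end SchrodingerHaar

end Literature.RepresentationTheory.HeisenbergGroup

end
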